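/-
Copyright (c) 2026 the pub-hodgecm-mathlib formalisation cell (harness21).  Prover seat hodgecm-mathlib-LH4-p12 (g4), Track A «(D-RAM) FOUR-FRAME», unit U2H, leaf (ρ2b′-X),
RHO2BX-ORDER v1 organ O-Cone — two binders of the line model discharged: `Θ h = h` and `h ≠ 0`.  2026-09-04.
-/
import Literature.NumberTheory.Automorphic.UnitaryLatticeTreeBlockGluing   -- ★ `pairing_comm_of_hermitian`; brings ★ `UnitaryLatticeTreeDefs` (`pairing`)
import HarnessLib

/-!
# The elliptic plane as a field line — the form constant `h` is `Θ`-fixed and non-zero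

In the LINE MODEL of an elliptic plane (★ `F0P3cDyRamEllipticPlaneLineModel.exists_lineModel`: an additive bijection `φ : E² → M`, `jE`-semilinear, with
`jE⟨x, y⟩_{H₂} = h·Θ(φx)·φy + ρ(h·Θ(φx)·φy)`), the constant `h` satisfies the two clauses that the census files (★ `EllipticPlaneAsFieldLine*`, ★ `F0P3cDyRamWSideOrderCensus`, ★
`F0P3cDyRamConeLevelTransport*`, ★ `F0P3cDyRamConeLevelCensus*`) take as binders `hΘh`, `hh`:
* `map_h_eq_h_of_hermitian` — **`Θ h = h`** when `H₂` is `σ`-HERMITIAN (`σ(H₂ a b) = H₂ b a`, `σσ = id`), `Θ` is an involution commuting with `ρ` and extending `σ` (`Θ ∘ jE = jE ∘ σ`), `φ` is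
  onto and `ρ` moves some element (`ρ α ≠ α`): comparing `⟨y, x⟩ = σ⟨x, y⟩` through the model gives `Tr((h − Θh)·m) = 0` for every `m`, and `m = 1`, `m = α` force `h = Θh`;
* `h_ne_zero_of_ne_zero` ∕ `h_ne_zero_of_isUnit_det` — **`h ≠ 0`** when `H₂ ≠ 0` (resp. `det H₂` is a unit): `h = 0` would make the pairing vanish identically.
[Jacobowitz1962, §4] (hermitian forms as trace forms `Tr(h·x̄y)` on a field line).

## References
* [Jacobowitz1962] R. Jacobowitz, *Hermitian forms over local fields*, Amer. J. Math. 84 (1962), §4.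
-/

set_option autoImplicit false

noncomputable section

open scoped Matrix
open Literature.NumberTheory.Automorphic Literature.NumberTheory.Automorphic.UnitaryLatticeTree

namespace Literature.NumberTheory.Automorphic.EllipticPlaneAsFieldLine

variable {E M : Type*} [Field E] [Field M]

/-- **`Θ h = h`** for the form constant of the line model of a HERMITIAN plane. [cite: Jacobowitz1962, §4] -/
theorem map_h_eq_h_of_hermitian (σ : E →+* E) (hσσ : ∀ a, σ (σ a) = a) {H₂ : Matrix (Fin 2) (Fin 2) E} (hH : ∀ a b, σ (H₂ a b) = H₂ b a)
    (jE : E →+* M) {ρ Θ : M →+* M} (hΘΘ : ∀ x, Θ (Θ x) = x) (hΘρ : ∀ x, Θ (ρ x) = ρ (Θ x)) (hΘj : ∀ c, Θ (jE c) = jE (σ c))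
    {α : M} (hα : ρ α ≠ α) (φ : (Fin 2 → E) →+ M) (hφo : Function.Surjective φ) {h : M}
    (hform : ∀ x y, jE (pairing σ H₂ x y) = h * Θ (φ x) * φ y + ρ (h * Θ (φ x) * φ y)) : Θ h = h := by
  -- `Tr((h − Θh)·m) = 0` for every `m`
  have key : ∀ m : M, (h - Θ h) * m + ρ ((h - Θ h) * m) = 0 := by
    intro m
    obtain ⟨x, hx⟩ := hφo m
    obtain ⟨y, hy⟩ := hφo 1
    have h1 : jE (σ (pairing σ H₂ x y)) = h * m + ρ (h * m) := by
      rw [← pairing_comm_of_hermitian hσσ hH x y, hform y x, hy, hx, map_one, mul_one]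
    have h2 : jE (σ (pairing σ H₂ x y)) = Θ h * m + ρ (Θ h * m) := by
      rw [← hΘj, hform x y, hx, hy, mul_one, map_add, hΘρ, map_mul, hΘΘ]
    have := h1.symm.trans h2
    rw [sub_mul, map_sub]
    linear_combination this
  have hc1 : (h - Θ h) + ρ (h - Θ h) = 0 := by simpa using key 1
  have hcα : (h - Θ h) * α + ρ (h - Θ h) * ρ α = 0 := by rw [← map_mul]; exact key α
  have hρc : ρ (h - Θ h) = -(h - Θ h) := eq_neg_of_add_eq_zero_right hc1
  rw [hρc] at hcα
  have hzero : (h - Θ h) * (α - ρ α) = 0 := by linear_combination hcα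
  rcases mul_eq_zero.1 hzero with h0 | h0
  · exact (sub_eq_zero.1 h0).symm
  · exact absurd (sub_eq_zero.1 h0).symm hα

/-- The pairing of two coordinate vectors reads the matrix entry: `⟨e_i, e_j⟩ = H i j` (`σ 1 = 1`). [cite: Jacobowitz1962, §4] -/
theorem pairing_single_single (σ : E →+* E) (H₂ : Matrix (Fin 2) (Fin 2) E) (i j : Fin 2) :
    pairing σ H₂ (Pi.single i 1) (Pi.single j 1) = H₂ i j := by
  rw [pairing_apply, Finset.sum_eq_single i, Finset.sum_eq_single j]
  · simp
  · intro b _ hb; simp [hb]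
  · simp
  · intro b _ hb; simp [Pi.single_apply, hb]
  · simp

/-- **`h ≠ 0`** for the form constant of the line model of a NON-ZERO form `H₂`. [cite: Jacobowitz1962, §4] -/
theorem h_ne_zero_of_ne_zero (σ : E →+* E) {H₂ : Matrix (Fin 2) (Fin 2) E} (hH0 : H₂ ≠ 0) (jE : E →+* M) {ρ Θ : M →+* M}
    (φ : (Fin 2 → E) →+ M) {h : M} (hform : ∀ x y, jE (pairing σ H₂ x y) = h * Θ (φ x) * φ y + ρ (h * Θ (φ x) * φ y)) : h ≠ 0 := by
  intro h0
  apply hH0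
  ext i j
  have hij := hform (Pi.single i 1) (Pi.single j 1)
  rw [pairing_single_single, h0, zero_mul, zero_mul, map_zero, add_zero, map_eq_zero_iff jE jE.injective] at hij
  rw [hij, Matrix.zero_apply]

/-- **`h ≠ 0`** when `det H₂` is a unit (the frame's `hH₂`). [cite: Jacobowitz1962, §4] -/
theorem h_ne_zero_of_isUnit_det (σ : E →+* E) {H₂ : Matrix (Fin 2) (Fin 2) E} (hH₂ : IsUnit H₂.det) (jE : E →+* M) {ρ Θ : M →+* M}
    (φ : (Fin 2 → E) →+ M) {h : M} (hform : ∀ x y, jE (pairing σ H₂ x y) = h * Θ (φ x) * φ y + ρ (h * Θ (φ x) * φ y)) : h ≠ 0 := by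
  refine h_ne_zero_of_ne_zero σ (fun hH0 => ?_) jE φ hform
  rw [hH0, Matrix.det_zero] at hH₂
  exact not_isUnit_zero hH₂

end Literature.NumberTheory.Automorphic.EllipticPlaneAsFieldLine

end
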